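import Summits.CriticalPhenomena.PercolationContinuityZ3.Theorems.PercNearOneGluingNoHeavyLowerTailKnQuestion8CoefficientwiseCoreClassKernelMixCycleFactor
import Summits.CriticalPhenomena.PercolationContinuityZ3.Theorems.PercNearOneGluingNoHeavyLowerTailKnQuestion8CoefficientwiseCoreClassKernelMixBundleWords

/-!
# Thread words and blue-run sets (L5 link, part 2: the colourings of one thread as a cycle / digon / loop factor)

Support file (`--supports stmt-CriticalPhenomena-4575`, closed), prover `prim-cplus-coupling` (gen 67).  No notations, no named facts, no sorries;
standard axioms.  Memo `prim-cplus-coupling/A5-COUPLING-gen66.md` §7.2 (i)–(ii) and `A5-COUPLING-gen67.md` §1.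

A thread of a bundle is the arc `wv 0 = u, wv 1, …, wv ℓ = b` with edge labels `ed 1, …, ed ℓ`.  For a colouring `σ` (the RED edges) the hub-merged blue
cluster meets the thread in its BLUE-RUN SET `bRun ℓ wv ed σ` = the interior vertices `wv j` (`1 ≤ j < ℓ`) whose whole initial segment `ed 1..ed j` or whole
final segment `ed (j+1)..ed ℓ` is blue.  The colouring of the thread is encoded by a WORD of the matching factor of the two-type theorem:
* `ℓ = n + 3` (cycle with `n + 1 ≥ 1` interior edges `ed 2, …, ed (n+2)`): `wordC n ed σ = (ed 1 ∈ σ, {i | ed (i+2) ∈ σ}, ed (n+3) ∈ σ) : Bool × Finset (Fin (n+1)) × Bool`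
  (`CycleWords`), with blue-run set `YtC n wv w` read off the word;
  (digon `ℓ = 2` and loop `ℓ = 1` words, and the cluster decomposition, are in `…KernelMixThreadWordsSmall`).
Proved here: the word determines the blue-run set (`ytC_wordC`, `bRun_one`); the three level-generating properties of `YtC` (antitone `ytC_anti`, maximal at the
single-hub-red words `ytC_RB`/`ytC_BR`, empty at both-hubs-red words `ytC_RR`); the word is an order embedding on the colourings of the thread (`wordC_le_iff`),
intertwines complementation with the mirror `CycleWords.cw` (`wordC_sdiff`), detects the fully red thread (`wordC_eq_top_iff`) and is onto (`wordC_surj`).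
[cite: KozmaNitzan2024, Questions 8–9 (§5.5 p. 36) (context); Harris 1960]
-/

namespace Summit.CriticalPhenomena.PercolationContinuityZ3.Theorems.Coefficientwise.ThreadWords

open Finset CycleWords CycleFactor Literature.Probability.Percolation

variable {ι V : Type*}

/-! ## Blue-run sets -/

/-- The blue-run set of a thread `wv 0, …, wv ℓ` with edge labels `ed 1, …, ed ℓ` under the colouring `σ` (red edges): the interior vertices `wv j`
whose initial segment `ed 1..ed j` or final segment `ed (j+1)..ed ℓ` avoids `σ`. -/
def bRun (ℓ : ℕ) (wv : ℕ → V) (ed : ℕ → ι) (σ : Finset ι) : Set V :=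
  {x | ∃ j, 1 ≤ j ∧ j < ℓ ∧ x = wv j ∧
    ((∀ j', 1 ≤ j' → j' ≤ j → ed j' ∉ σ) ∨ (∀ j', j < j' → j' ≤ ℓ → ed j' ∉ σ))}

/-- A unit thread has no interior vertex. -/
theorem bRun_one (wv : ℕ → V) (ed : ℕ → ι) (σ : Finset ι) : bRun 1 wv ed σ = ∅ := by
  ext x
  simp only [bRun, Set.mem_setOf_eq, Set.mem_empty_iff_false, iff_false]
  rintro ⟨j, hj1, hj2, -⟩; omega

/-- The blue-run set only depends on the colours of the thread's own edges. -/
theorem bRun_congr (ℓ : ℕ) (wv : ℕ → V) (ed : ℕ → ι) {σ σ' : Finset ι} (h : ∀ j, 1 ≤ j → j ≤ ℓ → (ed j ∈ σ ↔ ed j ∈ σ')) :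
    bRun ℓ wv ed σ = bRun ℓ wv ed σ' := by
  ext x
  simp only [bRun, Set.mem_setOf_eq]
  refine exists_congr fun j => ?_
  refine and_congr_right fun hj1 => and_congr_right fun hjl => and_congr_right fun _ => ?_
  refine or_congr (forall_congr' fun j' => ?_) (forall_congr' fun j' => ?_)
  · refine forall_congr' fun h1 => forall_congr' fun h2 => ?_
    rw [h j' h1 (by omega)]
  · refine forall_congr' fun h1 => forall_congr' fun h2 => ?_
    rw [h j' (by omega) h2]

/-! ## Cycle words (`ℓ = n + 3`) -/

open Classical in
/-- The cycle word of a thread of length `n + 3`: first hub letter, red interior edges (`i ↦ ed (i+2)`), last hub letter (`true` = red). -/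
noncomputable def wordC (n : ℕ) (ed : ℕ → ι) (σ : Finset ι) : Bool × Finset (Fin (n + 1)) × Bool :=
  (decide (ed 1 ∈ σ), ((univ : Finset (Fin (n + 1))).filter (fun i => ed ((i : ℕ) + 2) ∈ σ), decide (ed (n + 3) ∈ σ)))

/-- Edge `j` (`1 ≤ j ≤ n + 3`) is BLUE in the word `w`. -/
def BlueAt (n : ℕ) (w : Bool × Finset (Fin (n + 1)) × Bool) (j : ℕ) : Prop :=
  (j = 1 → w.1 = false) ∧ (∀ i : Fin (n + 1), (i : ℕ) + 2 = j → i ∉ w.2.1) ∧ (j = n + 3 → w.2.2 = false)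

/-- The blue-run set read off a cycle word. -/
def YtC (n : ℕ) (wv : ℕ → V) (w : Bool × Finset (Fin (n + 1)) × Bool) : Set V :=
  {x | ∃ j, 1 ≤ j ∧ j < n + 3 ∧ x = wv j ∧
    ((∀ j', 1 ≤ j' → j' ≤ j → BlueAt n w j') ∨ (∀ j', j < j' → j' ≤ n + 3 → BlueAt n w j'))}

open Classical in
/-- The word records the colour of every edge of the thread. -/
theorem blueAt_wordC (n : ℕ) (ed : ℕ → ι) (σ : Finset ι) (j : ℕ) (hj1 : 1 ≤ j) (hj2 : j ≤ n + 3) :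
    BlueAt n (wordC n ed σ) j ↔ ed j ∉ σ := by
  simp only [BlueAt, wordC]
  constructor
  · rintro ⟨h1, hint, hL⟩
    by_cases hj : j = 1
    · subst hj; exact of_decide_eq_false (h1 rfl)
    by_cases hj' : j = n + 3
    · subst hj'; exact of_decide_eq_false (hL rfl)
    · have hlt : j - 2 < n + 1 := by omega
      have h := hint ⟨j - 2, hlt⟩ (by simp only; omega)
      rw [mem_filter, show j - 2 + 2 = j by omega] at h
      exact fun hm => h ⟨mem_univ _, hm⟩
  · intro h
    refine ⟨fun hj => ?_, fun i hi => ?_, fun hj => ?_⟩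
    · subst hj; exact decide_eq_false h
    · rw [mem_filter, hi]; exact fun hm => h hm.2
    · subst hj; exact decide_eq_false h

open Classical in
/-- **The word determines the blue-run set** (cycle case). -/
theorem ytC_wordC (n : ℕ) (wv : ℕ → V) (ed : ℕ → ι) (σ : Finset ι) : YtC n wv (wordC n ed σ) = bRun (n + 3) wv ed σ := by
  ext x
  simp only [YtC, bRun, Set.mem_setOf_eq]
  refine exists_congr fun j => ?_
  refine and_congr_right fun hj1 => and_congr_right fun hjl => and_congr_right fun _ => ?_
  refine or_congr (forall_congr' fun j' => ?_) (forall_congr' fun j' => ?_)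
  · refine forall_congr' fun h1 => forall_congr' fun h2 => ?_
    exact blueAt_wordC n ed σ j' h1 (by omega)
  · refine forall_congr' fun h1 => forall_congr' fun h2 => ?_
    exact blueAt_wordC n ed σ j' (by omega) h2

/-- Blue edges of a bigger word are blue in a smaller word. -/
theorem blueAt_anti (n : ℕ) {w w' : Bool × Finset (Fin (n + 1)) × Bool} (hle : w ≤ w') (j : ℕ) (h : BlueAt n w' j) : BlueAt n w j := by
  obtain ⟨a, μ, c⟩ := w
  obtain ⟨a', μ', c'⟩ := w'
  obtain ⟨ha, hμ, hc⟩ : a ≤ a' ∧ μ ⊆ μ' ∧ c ≤ c' := ⟨hle.1, hle.2.1, hle.2.2⟩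
  obtain ⟨h1, hint, hL⟩ := h
  refine ⟨fun hj => ?_, fun i hi hm => hint i hi (hμ hm), fun hj => ?_⟩
  · have := h1 hj; simp only at this ⊢; subst this
    revert ha; cases a <;> simp
  · have := hL hj; simp only at this ⊢; subst this
    revert hc; cases c <;> simp

/-- **`YtC` is antitone in the word.** -/
theorem ytC_anti (n : ℕ) (wv : ℕ → V) {w w' : Bool × Finset (Fin (n + 1)) × Bool} (hle : w ≤ w') : YtC n wv w' ⊆ YtC n wv w := by
  rintro x ⟨j, hj1, hjl, rfl, h⟩
  refine ⟨j, hj1, hjl, rfl, ?_⟩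
  rcases h with h | h
  · exact Or.inl fun j' h1 h2 => blueAt_anti n hle j' (h j' h1 h2)
  · exact Or.inr fun j' h1 h2 => blueAt_anti n hle j' (h j' h1 h2)

/-- **`YtC` is maximal at the single-hub-red word `(R, ∅, B)`** (everything is reached along the blue final segments). -/
theorem ytC_RB (n : ℕ) (wv : ℕ → V) (w : Bool × Finset (Fin (n + 1)) × Bool) : YtC n wv w ⊆ YtC n wv (true, (∅, false)) := by
  rintro x ⟨j, hj1, hjl, rfl, -⟩
  refine ⟨j, hj1, hjl, rfl, Or.inr fun j' h1 _ => ⟨fun h => absurd h (by omega), fun i _ => notMem_empty i, fun _ => rfl⟩⟩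

/-- **`YtC` is maximal at the single-hub-red word `(B, ∅, R)`** (everything is reached along the blue initial segments). -/
theorem ytC_BR (n : ℕ) (wv : ℕ → V) (w : Bool × Finset (Fin (n + 1)) × Bool) : YtC n wv w ⊆ YtC n wv (false, (∅, true)) := by
  rintro x ⟨j, hj1, hjl, rfl, -⟩
  refine ⟨j, hj1, hjl, rfl, Or.inl fun j' _ h2 => ⟨fun _ => rfl, fun i _ => notMem_empty i, fun h => absurd h (by omega)⟩⟩

/-- **`YtC` is empty at every word with both hub letters red.** -/
theorem ytC_RR (n : ℕ) (wv : ℕ → V) (μ : Finset (Fin (n + 1))) : YtC n wv (true, (μ, true)) = ∅ := by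
  ext x
  simp only [YtC, Set.mem_setOf_eq, Set.mem_empty_iff_false, iff_false]
  rintro ⟨j, hj1, hjl, -, h⟩
  rcases h with h | h
  · have := (h 1 le_rfl hj1).1 rfl; simp at this
  · have := (h (n + 3) hjl le_rfl).2.2 rfl; simp at this

open Classical in
/-- The word only depends on the colours of the thread's own edges. -/
theorem wordC_congr (n : ℕ) (ed : ℕ → ι) {σ σ' : Finset ι} (h : ∀ j, 1 ≤ j → j ≤ n + 3 → (ed j ∈ σ ↔ ed j ∈ σ')) :
    wordC n ed σ = wordC n ed σ' := by
  simp only [wordC, Prod.mk.injEq]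
  refine ⟨?_, ?_, ?_⟩
  · rw [Bool.eq_iff_iff, decide_eq_true_iff, decide_eq_true_iff]; exact h 1 le_rfl (by omega)
  · exact filter_congr fun i _ => h _ (by omega) (by omega)
  · rw [Bool.eq_iff_iff, decide_eq_true_iff, decide_eq_true_iff]; exact h _ (by omega) le_rfl

open Classical in
/-- **The word is an order embedding** on the colourings of the thread. -/
theorem wordC_le_iff (n : ℕ) (ed : ℕ → ι) (σ σ' : Finset ι) :
    wordC n ed σ ≤ wordC n ed σ' ↔ ∀ j, 1 ≤ j → j ≤ n + 3 → ed j ∈ σ → ed j ∈ σ' := by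
  constructor
  · intro hle j hj1 hj2 hj
    obtain ⟨ha, hμ, hc⟩ : (wordC n ed σ).1 ≤ (wordC n ed σ').1 ∧ (wordC n ed σ).2.1 ⊆ (wordC n ed σ').2.1 ∧
        (wordC n ed σ).2.2 ≤ (wordC n ed σ').2.2 := ⟨hle.1, hle.2.1, hle.2.2⟩
    by_cases h1 : j = 1
    · subst h1
      have := Bool.le_iff_imp.mp ha
      simp only [wordC, decide_eq_true_eq] at this
      exact this hj
    by_cases hL : j = n + 3
    · subst hL
      have := Bool.le_iff_imp.mp hc
      simp only [wordC, decide_eq_true_eq] at this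
      exact this hj
    · have hlt : j - 2 < n + 1 := by omega
      have hm : (⟨j - 2, hlt⟩ : Fin (n + 1)) ∈ (wordC n ed σ).2.1 := by
        simp only [wordC, mem_filter, mem_univ, true_and]
        rwa [show j - 2 + 2 = j by omega]
      have hm' := hμ hm
      simp only [wordC, mem_filter, mem_univ, true_and] at hm'
      rwa [show j - 2 + 2 = j by omega] at hm'
  · intro h
    refine ⟨Bool.le_iff_imp.mpr ?_, ?_, Bool.le_iff_imp.mpr ?_⟩
    · simp only [wordC, decide_eq_true_eq]; exact h 1 le_rfl (by omega)
    · intro i hi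
      simp only [wordC, mem_filter, mem_univ, true_and] at hi ⊢
      exact h _ (by omega) (by omega) hi
    · simp only [wordC, decide_eq_true_eq]; exact h _ (by omega) le_rfl

open Classical in
/-- **The word of the complementary colouring is the mirror word.** -/
theorem wordC_sdiff (n : ℕ) (ed : ℕ → ι) (F σ : Finset ι) (hF : ∀ j, 1 ≤ j → j ≤ n + 3 → ed j ∈ F) :
    wordC n ed (F \ σ) = cw (wordC n ed σ) := by
  simp only [wordC, cw_apply, Prod.mk.injEq]
  refine ⟨?_, ?_, ?_⟩
  · rw [Bool.eq_iff_iff]; simp [mem_sdiff, hF 1 le_rfl (by omega)]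
  · ext i; simp [mem_sdiff, hF _ (by omega : 1 ≤ (i : ℕ) + 2) (by omega)]
  · rw [Bool.eq_iff_iff]; simp [mem_sdiff, hF _ (by omega : 1 ≤ n + 3) le_rfl]

open Classical in
/-- **The word is the full word iff the thread is fully red.** -/
theorem wordC_eq_top_iff (n : ℕ) (ed : ℕ → ι) (σ : Finset ι) :
    wordC n ed σ = topW (Fin (n + 1)) ↔ ∀ j, 1 ≤ j → j ≤ n + 3 → ed j ∈ σ := by
  constructor
  · intro h j hj1 hj2
    simp only [wordC, topW, Prod.mk.injEq, decide_eq_true_eq] at h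
    obtain ⟨h1, hμ, hL⟩ := h
    by_cases hj : j = 1
    · subst hj; exact h1
    by_cases hj' : j = n + 3
    · subst hj'; exact hL
    · have hlt : j - 2 < n + 1 := by omega
      have hm : (⟨j - 2, hlt⟩ : Fin (n + 1)) ∈ (univ : Finset (Fin (n + 1))).filter (fun i : Fin (n + 1) => ed ((i : ℕ) + 2) ∈ σ) := by
        rw [hμ]; exact mem_univ _
      simp only [mem_filter, mem_univ, true_and] at hm
      rwa [show j - 2 + 2 = j by omega] at hm
  · intro h
    simp only [wordC, topW, Prod.mk.injEq, decide_eq_true_eq]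
    refine ⟨h 1 le_rfl (by omega), ?_, h _ (by omega) le_rfl⟩
    ext i; simp only [mem_filter, mem_univ, true_and, iff_true]; exact h _ (by omega) (by omega)

open Classical in
/-- **Every word is the word of a colouring of the thread** (edge labels pairwise distinct). -/
theorem wordC_surj (n : ℕ) (ed : ℕ → ι) (hed : ∀ i j, 1 ≤ i → i ≤ n + 3 → 1 ≤ j → j ≤ n + 3 → ed i = ed j → i = j)
    (At : Finset ι) (hAt : ∀ i, i ∈ At ↔ ∃ j, 1 ≤ j ∧ j ≤ n + 3 ∧ ed j = i) (wd : Bool × Finset (Fin (n + 1)) × Bool) :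
    ∃ ρ : Finset ι, ρ ⊆ At ∧ wordC n ed ρ = wd := by
  obtain ⟨a, μ, c⟩ := wd
  refine ⟨At.filter (fun i => (i = ed 1 ∧ a = true) ∨ (∃ k : Fin (n + 1), k ∈ μ ∧ i = ed ((k : ℕ) + 2)) ∨ (i = ed (n + 3) ∧ c = true)),
    filter_subset _ _, ?_⟩
  have hmem : ∀ j, 1 ≤ j → j ≤ n + 3 → (ed j ∈ At.filter (fun i => (i = ed 1 ∧ a = true) ∨
      (∃ k : Fin (n + 1), k ∈ μ ∧ i = ed ((k : ℕ) + 2)) ∨ (i = ed (n + 3) ∧ c = true)) ↔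
      ((j = 1 ∧ a = true) ∨ (∃ k : Fin (n + 1), k ∈ μ ∧ j = (k : ℕ) + 2) ∨ (j = n + 3 ∧ c = true))) := by
    intro j hj1 hj2
    rw [mem_filter]
    have hA : ed j ∈ At := (hAt _).mpr ⟨j, hj1, hj2, rfl⟩
    simp only [hA, true_and]
    refine or_congr ?_ (or_congr ?_ ?_)
    · refine and_congr_left fun _ => ⟨fun h => hed _ _ hj1 hj2 le_rfl (by omega) h, fun h => by rw [h]⟩
    · refine exists_congr fun k => and_congr_right fun _ => ⟨fun h => hed _ _ hj1 hj2 (by omega) (by omega) h, fun h => by rw [h]⟩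
    · refine and_congr_left fun _ => ⟨fun h => hed _ _ hj1 hj2 (by omega) le_rfl h, fun h => by rw [h]⟩
  simp only [wordC, Prod.mk.injEq]
  refine ⟨?_, ?_, ?_⟩
  · rw [Bool.eq_iff_iff, decide_eq_true_iff, hmem 1 le_rfl (by omega)]
    constructor
    · rintro (⟨-, h⟩ | ⟨k, -, hk⟩ | ⟨h, -⟩)
      · exact h
      · omega
      · omega
    · exact fun h => Or.inl ⟨rfl, h⟩
  · ext i
    rw [mem_filter, hmem _ (by omega) (by omega)]
    simp only [mem_univ, true_and]
    constructor
    · rintro (⟨h, -⟩ | ⟨k, hk, hki⟩ | ⟨h, -⟩)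
      · omega
      · have : k = i := Fin.ext (by omega)
        exact this ▸ hk
      · omega
    · exact fun h => Or.inr (Or.inl ⟨i, h, rfl⟩)
  · rw [Bool.eq_iff_iff, decide_eq_true_iff, hmem _ (by omega) le_rfl]
    constructor
    · rintro (⟨h, -⟩ | ⟨k, -, hk⟩ | ⟨-, h⟩)
      · omega
      · omega
      · exact h
    · exact fun h => Or.inr (Or.inr ⟨rfl, h⟩)

end Summit.CriticalPhenomena.PercolationContinuityZ3.Theorems.Coefficientwise.ThreadWords
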